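import Literature.Geometry.Symplectic.SphereCROperatorBanach
import Literature.Geometry.Symplectic.SphereCROperatorVariation
import Literature.Geometry.Symplectic.SphereCROperatorZeroSection
import HarnessLib

/-!
# The derivative of the chart Cauchy–Riemann operators at the zero section, chartwise

Layer B4c of the analytic core of the Hofer–Lizan–Sikorav local foliation theorem (Wendl 2018,
Thm. 2.46; lead of crux `WitnessCharge`, summit `SmoothPoincare4`). For chart data
`𝒥 : SphereACData` the smooth Banach maps `PT`, `PN` of `SphereCROperatorBanach.lean`
(tangent / normal pieces of the chart Cauchy–Riemann operators on
`SecPair k r = 𝓗^{k+1,r}_{-w²} × 𝓗^{k+1,r}_1`) have derivatives `dPT 0`, `dPN 0` at the zero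
section given pointwise by the Nemytskii formula `ρ z • Dφ₀(jets₀ 0 z) (jets₀CLM δ z)`. Here
(for `k ≥ 1`, so representatives are `C²`) we EVALUATE them:

* `fderiv_jetOp₀_axis_apply`: the Fréchet derivative of the jet operator at a zero-section jet in
  a jet direction is the first variation of `crOp₀` (`hasDerivAt_crOp₀_variation` at `ξ = f = 0`),
  hence (ZeroSection) block triangular with Cauchy–Riemann diagonal:
* `dPN_zero_fst_apply : (dPN 0 δ).1 z = ρ z • (∂ₓ δf⁰ + I ∂_y δf⁰ + a₀(z) δf⁰(z))`,
  `dPN_zero_snd_apply` (chart `1`, coefficient `a₁ = (𝒥.swap).a₀`), and the tangent rows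
  `dPT_zero_fst_apply`, `dPT_zero_snd_apply` (`∂ₓ δξ + I ∂_y δξ + m(δf-jet)`);
* `aCoeff_clutch : a₁ w x = dbarClutch 1 w • a₀ w⁻¹ x` (`w ≠ 0`): the coefficient fields of the
  normal row form a `Hom(𝒪, Λ⁰¹)`-valued function — by differentiating the clutching law
  `crOp₁_eq` along the family `f = s • x` of constant functions.

## References

* C. Wendl, *Holomorphic Curves in Low Dimensions*, LNM 2216 (2018), §2.3, Thm. 2.46. [Wendl2018]
-/

noncomputable section

open Set Filter Metric Function Complex
open scoped Topology NNReal ContDiff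
open Literature.Analysis.FunctionSpaces Literature.Analysis.Complex.RiemannSphere
open Literature.Analysis.Complex.ProjectiveLineExpChart Literature.Geometry.Symplectic.CRExpression

namespace Literature.Geometry.Symplectic

namespace SphereCR

namespace SphereACData

variable (𝒥 : SphereACData)

/-! ### The Cauchy–Riemann expression vanishes along the zero section -/

/-- `crExpr J₀ (vmap₀ 0 0) z = 0`: the zero section with its chart parametrisation is
`J₀`-holomorphic (`axis₀`). [cite: Wendl2018, Thm. 2.46] -/
theorem crExpr_vmap₀_zero (z : ℂ) : crExpr 𝒥.J₀ (𝒥.vmap₀ 0 0) z = 0 := by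
  rw [crExpr_def, 𝒥.fderiv_vmap₀_zero, ContinuousLinearMap.inl_apply,
    ContinuousLinearMap.inl_apply, 𝒥.vmap₀_zero, 𝒥.axis₀]
  ext <;> simp

/-! ### The derivative of the jet operator at a zero-section jet -/

section Axis

variable {δξ δf : ℂ → ℂ}

/-- **The jet operator along the line of jets of `s ↦ (s δξ, s δf)`** has, at `s = 0`, the
derivative given by the first-variation formula at the zero section. [cite: Wendl2018, Thm. 2.46] -/
theorem hasDerivAt_jetOp₀_line (hδξ : ContDiff ℝ 2 δξ) (hδf : ContDiff ℝ 2 δf) (z : ℂ) :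
    HasDerivAt (fun s : ℝ => 𝒥.jetOp₀
        (z, s • δξ z, s • fderiv ℝ δξ z, s • δf z, s • fderiv ℝ δf z))
      (𝒥.Phi₀ 0 0 z
        (fderiv ℝ (fun z' => ((δξ z', 𝒥.Qinv₀ z' (δf z')) : ℂ × ℂ)) z 1 +
          𝒥.J₀ (𝒥.vmap₀ 0 0 z) (fderiv ℝ (fun z' => ((δξ z', 𝒥.Qinv₀ z' (δf z')) : ℂ × ℂ)) z I) +
          (fderiv ℝ 𝒥.J₀ (𝒥.vmap₀ 0 0 z) (δξ z, 𝒥.Qinv₀ z (δf z)))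
            (fderiv ℝ (𝒥.vmap₀ 0 0) z I))) 0 := by
  have h := 𝒥.hasDerivAt_crOp₀_variation (ξ₁ := 0) (f₁ := 0) contDiff_const contDiff_const hδξ hδf
    (by simpa using den_zero_ne_zero z) (𝒥.crExpr_vmap₀_zero z)
  rw [𝒥.dvmap₀_zero_eq] at h
  refine h.congr_of_eventuallyEq ?_
  -- for `s` near `0` the operator is in jet form
  have hden : ∀ᶠ s : ℝ in 𝓝 0, den z ((0 + s • δξ) z) ≠ 0 := by
    have hc : Continuous fun s : ℝ => den z ((0 + s • δξ) z) := by
      have : (fun s : ℝ => den z ((0 + s • δξ) z)) = fun s : ℝ => den z ((s : ℂ) * δξ z) := by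
        funext s; simp [Complex.real_smul]
      rw [this]
      unfold den
      fun_prop
    exact hc.continuousAt.eventually_ne (by simpa using den_zero_ne_zero z)
  filter_upwards [hden] with s hs
  have hdξ : DifferentiableAt ℝ (0 + s • δξ) z :=
    ((hδξ.differentiable (by simp)).const_smul s).differentiableAt.const_add _ |>.congr_of_eventuallyEq
      (Eventually.of_forall fun _ => rfl)
  have hdf : DifferentiableAt ℝ (0 + s • δf) z :=
    ((hδf.differentiable (by simp)).const_smul s).differentiableAt.const_add _ |>.congr_of_eventuallyEq
      (Eventually.of_forall fun _ => rfl)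
  rw [𝒥.crOp₀_eq_jetOp₀ hdξ hdf hs]
  have e1 : (0 + s • δξ) z = s • δξ z := by simp
  have e2 : (0 + s • δf) z = s • δf z := by simp
  have e3 : fderiv ℝ (0 + s • δξ) z = s • fderiv ℝ δξ z := by
    rw [zero_add]
    exact fderiv_const_smul ((hδξ.differentiable (by simp)).differentiableAt) s
  have e4 : fderiv ℝ (0 + s • δf) z = s • fderiv ℝ δf z := by
    rw [zero_add]
    exact fderiv_const_smul ((hδf.differentiable (by simp)).differentiableAt) s
  rw [e1, e2, e3, e4]

/-- **The Fréchet derivative of the jet operator at the zero-section jet `(z, 0, 0, 0, 0)` in the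
direction of the 1-jet of `(δξ, δf)` at `z`** is the first variation of `crOp₀` at the zero
section. [cite: Wendl2018, Thm. 2.46] -/
theorem fderiv_jetOp₀_axis_apply (hδξ : ContDiff ℝ 2 δξ) (hδf : ContDiff ℝ 2 δf) (z : ℂ) :
    fderiv ℝ 𝒥.jetOp₀ (z, 0, 0, 0, 0) ((0 : ℂ), δξ z, fderiv ℝ δξ z, δf z, fderiv ℝ δf z) =
      𝒥.Phi₀ 0 0 z
        (fderiv ℝ (fun z' => ((δξ z', 𝒥.Qinv₀ z' (δf z')) : ℂ × ℂ)) z 1 +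
          𝒥.J₀ (𝒥.vmap₀ 0 0 z) (fderiv ℝ (fun z' => ((δξ z', 𝒥.Qinv₀ z' (δf z')) : ℂ × ℂ)) z I) +
          (fderiv ℝ 𝒥.J₀ (𝒥.vmap₀ 0 0 z) (δξ z, 𝒥.Qinv₀ z (δf z)))
            (fderiv ℝ (𝒥.vmap₀ 0 0) z I)) := by
  set v : Jet := ((0 : ℂ), δξ z, fderiv ℝ δξ z, δf z, fderiv ℝ δf z) with hv
  have hd : DifferentiableAt ℝ 𝒥.jetOp₀ ((z : ℂ), (0 : ℂ), (0 : ℂ →L[ℝ] ℂ), (0 : ℂ),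
      (0 : ℂ →L[ℝ] ℂ)) :=
    (𝒥.contDiffAt_jetOp₀ (by simp)).differentiableAt (by simp)
  have hline : HasDerivAt (fun s : ℝ => 𝒥.jetOp₀ (((z : ℂ), (0 : ℂ), (0 : ℂ →L[ℝ] ℂ), (0 : ℂ),
      (0 : ℂ →L[ℝ] ℂ)) + s • v)) (fderiv ℝ 𝒥.jetOp₀ (z, 0, 0, 0, 0) v) 0 :=
    hd.hasFDerivAt.comp_hasDerivAt_of_eq 0 (hasDerivAt_const_add_smul _ v 0) (by rw [zero_smul ℝ v, add_zero])
  have heq : (fun s : ℝ => 𝒥.jetOp₀ (((z : ℂ), (0 : ℂ), (0 : ℂ →L[ℝ] ℂ), (0 : ℂ),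
      (0 : ℂ →L[ℝ] ℂ)) + s • v)) =
      fun s : ℝ => 𝒥.jetOp₀ (z, s • δξ z, s • fderiv ℝ δξ z, s • δf z, s • fderiv ℝ δf z) := by
    funext s
    simp [hv]
  rw [heq] at hline
  exact hline.unique (𝒥.hasDerivAt_jetOp₀_line hδξ hδf z)

/-- **Normal row**: `(D jetOp₀ (z,0,0,0,0) [jet])₂ = ∂ₓ δf + I ∂_y δf + a₀(z) (δf z)`.
[cite: Wendl2018, Thm. 2.46] -/
theorem fderiv_jetOp₀_axis_apply_snd (hδξ : ContDiff ℝ 2 δξ) (hδf : ContDiff ℝ 2 δf) (z : ℂ) :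
    (fderiv ℝ 𝒥.jetOp₀ (z, 0, 0, 0, 0) ((0 : ℂ), δξ z, fderiv ℝ δξ z, δf z, fderiv ℝ δf z)).2 =
      fderiv ℝ δf z 1 + I * fderiv ℝ δf z I + 𝒥.aCoeff₀ z (δf z) := by
  rw [𝒥.fderiv_jetOp₀_axis_apply hδξ hδf]
  exact 𝒥.linearisation_zero_snd ((hδξ.differentiable (by simp)).differentiableAt)
    ((hδf.differentiable (by simp)).differentiableAt)

/-- **Tangent row**: `(D jetOp₀ (z,0,0,0,0) [jet])₁ = ∂ₓ δξ + I ∂_y δξ + m₀(z) (δf z, D δf z)`.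
[cite: Wendl2018, Thm. 2.46] -/
theorem fderiv_jetOp₀_axis_apply_fst (hδξ : ContDiff ℝ 2 δξ) (hδf : ContDiff ℝ 2 δf) (z : ℂ) :
    (fderiv ℝ 𝒥.jetOp₀ (z, 0, 0, 0, 0) ((0 : ℂ), δξ z, fderiv ℝ δξ z, δf z, fderiv ℝ δf z)).1 =
      fderiv ℝ δξ z 1 + I * fderiv ℝ δξ z I + 𝒥.mCoeff₀ z (δf z, fderiv ℝ δf z) := by
  rw [𝒥.fderiv_jetOp₀_axis_apply hδξ hδf]
  exact 𝒥.linearisation_zero_fst ((hδξ.differentiable (by simp)).differentiableAt)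
    ((hδf.differentiable (by simp)).differentiableAt)

end Axis

/-! ### Chart `1`: the coefficients of the swapped data -/

/-- The zeroth-order coefficient of the normal row in chart `1`: that of the swapped data.
[cite: Wendl2018, Thm. 2.46] -/
def aCoeff₁ (w : ℂ) : ℂ →L[ℝ] ℂ := 𝒥.swap.aCoeff₀ w

/-- The coupling coefficient of the tangent row in chart `1`. [cite: Wendl2018, Thm. 2.46] -/
def mCoeff₁ (w : ℂ) : ℂ × (ℂ →L[ℝ] ℂ) →L[ℝ] ℂ := 𝒥.swap.mCoeff₀ w

/-- `aCoeff₁` is smooth. [folklore] -/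
theorem contDiff_aCoeff₁ : ContDiff ℝ ∞ 𝒥.aCoeff₁ := 𝒥.swap.contDiff_aCoeff₀

/-- Normal row in chart `1`. [cite: Wendl2018, Thm. 2.46] -/
theorem fderiv_jetOp₁_axis_apply_snd {δξ δf : ℂ → ℂ} (hδξ : ContDiff ℝ 2 δξ)
    (hδf : ContDiff ℝ 2 δf) (w : ℂ) :
    (fderiv ℝ 𝒥.jetOp₁ (w, 0, 0, 0, 0) ((0 : ℂ), δξ w, fderiv ℝ δξ w, δf w, fderiv ℝ δf w)).2 =
      fderiv ℝ δf w 1 + I * fderiv ℝ δf w I + 𝒥.aCoeff₁ w (δf w) :=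
  𝒥.swap.fderiv_jetOp₀_axis_apply_snd hδξ hδf w

/-- Tangent row in chart `1`. [cite: Wendl2018, Thm. 2.46] -/
theorem fderiv_jetOp₁_axis_apply_fst {δξ δf : ℂ → ℂ} (hδξ : ContDiff ℝ 2 δξ)
    (hδf : ContDiff ℝ 2 δf) (w : ℂ) :
    (fderiv ℝ 𝒥.jetOp₁ (w, 0, 0, 0, 0) ((0 : ℂ), δξ w, fderiv ℝ δξ w, δf w, fderiv ℝ δf w)).1 =
      fderiv ℝ δξ w 1 + I * fderiv ℝ δξ w I + 𝒥.mCoeff₁ w (δf w, fderiv ℝ δf w) :=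
  𝒥.swap.fderiv_jetOp₀_axis_apply_fst hδξ hδf w

/-! ### The clutching of the normal-row coefficients -/

/-- **The coefficient fields of the normal row clutch as a `Hom(𝒪, Λ⁰¹)`-valued function**:
`a₁ z⁻¹ x = dbarClutch 1 z⁻¹ • a₀ z x` for `z ≠ 0` — differentiate the clutching law `crOp₁_eq`
along the family of constant functions `f = s • x` (`ξ = 0`) at `s = 0`. [cite: Wendl2018, Thm. 2.46] -/
theorem aCoeff₁_inv_apply {z : ℂ} (hz : z ≠ 0) (x : ℂ) :
    𝒥.aCoeff₁ z⁻¹ x = dbarClutch (1 : ℂ → ℂ) z⁻¹ • 𝒥.aCoeff₀ z x := by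
  -- the two one-parameter families and their derivatives at `s = 0`
  have hcx : ContDiff ℝ 2 (fun _ : ℂ => x) := contDiff_const
  have hc0 : ContDiff ℝ 2 (0 : ℂ → ℂ) := contDiff_const
  have hG := 𝒥.hasDerivAt_crOp₀_variation (ξ₁ := 0) (f₁ := 0) (δξ := 0) (δf := fun _ => x)
    (z := z) hc0 hc0 hc0 hcx (by simpa using den_zero_ne_zero z) (𝒥.crExpr_vmap₀_zero z)
  have hF := 𝒥.swap.hasDerivAt_crOp₀_variation (ξ₁ := 0) (f₁ := 0) (δξ := 0) (δf := fun _ => x)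
    (z := z⁻¹) hc0 hc0 hc0 hcx (by simpa using den_zero_ne_zero z⁻¹) (𝒥.swap.crExpr_vmap₀_zero z⁻¹)
  -- second components of the two derivatives
  have hG2 := 𝒥.linearisation_zero_snd (δξ := (0 : ℂ → ℂ)) (δf := fun _ : ℂ => x) (z := z)
    (differentiableAt_const _) (differentiableAt_const _)
  have hF2 := 𝒥.swap.linearisation_zero_snd (δξ := (0 : ℂ → ℂ)) (δf := fun _ : ℂ => x) (z := z⁻¹)
    (differentiableAt_const _) (differentiableAt_const _)
  rw [𝒥.dvmap₀_zero_eq] at hG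
  rw [𝒥.swap.dvmap₀_zero_eq] at hF
  simp only [Pi.zero_apply] at hG hF hG2 hF2
  simp only [fderiv_fun_const, FunLike.coe_zero, Pi.zero_apply, mul_zero, zero_add] at hG2 hF2
  -- differentiability of the (constant) members of the family
  have hd0 : ∀ s : ℝ, DifferentiableAt ℝ (0 + s • (0 : ℂ → ℂ)) z := fun s => by
    have : (0 + s • (0 : ℂ → ℂ)) = fun _ => (0 : ℂ) := by funext w; simp
    rw [this]; exact differentiableAt_const _
  have hdx : ∀ s : ℝ, DifferentiableAt ℝ (0 + s • fun _ : ℂ => x) z := fun s => by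
    have : (0 + s • fun _ : ℂ => x) = fun _ => (s : ℂ) * x := by
      funext w; simp [Complex.real_smul]
    rw [this]; exact differentiableAt_const _
  -- the clutching law along the family
  have hrel : ∀ s : ℝ, 𝒥.crOp₁ (0 + s • (0 : ℂ → ℂ)) (0 + s • fun _ : ℂ => x) z⁻¹ =
      ((z⁻¹ ^ 2 * ((starRingEnd ℂ) z⁻¹)⁻¹ ^ 2) *
          (𝒥.crOp₀ (0 + s • (0 : ℂ → ℂ)) (0 + s • fun _ : ℂ => x) z).1,
        (-((starRingEnd ℂ) z⁻¹)⁻¹ ^ 2) *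
          (𝒥.crOp₀ (0 + s • (0 : ℂ → ℂ)) (0 + s • fun _ : ℂ => x) z).2) := by
    intro s
    refine 𝒥.crOp₁_eq hz (hd0 s) (hdx s) (Eventually.of_forall fun w => by simp)
      (Eventually.of_forall fun w => by simp) (by simpa using den_zero_ne_zero z) ?_
    have h1 : (1 + (Complex.normSq z : ℂ)) ≠ 0 := by
      exact_mod_cast (add_pos_of_pos_of_nonneg one_pos (Complex.normSq_nonneg z)).ne'
    simpa using mul_ne_zero hz h1
  -- derivative of the right-hand side family
  have hR : HasDerivAt (fun s : ℝ =>
      (((z⁻¹ ^ 2 * ((starRingEnd ℂ) z⁻¹)⁻¹ ^ 2) *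
          (𝒥.crOp₀ (0 + s • (0 : ℂ → ℂ)) (0 + s • fun _ : ℂ => x) z).1,
        (-((starRingEnd ℂ) z⁻¹)⁻¹ ^ 2) *
          (𝒥.crOp₀ (0 + s • (0 : ℂ → ℂ)) (0 + s • fun _ : ℂ => x) z).2) : ℂ × ℂ)) _ 0 :=
    (((ContinuousLinearMap.fst ℝ ℂ ℂ).hasFDerivAt.comp_hasDerivAt 0 hG).const_mul _).prodMk
      (((ContinuousLinearMap.snd ℝ ℂ ℂ).hasFDerivAt.comp_hasDerivAt 0 hG).const_mul _)
  have hF' := hR.congr_of_eventuallyEq (Eventually.of_forall fun s => (hrel s))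
  -- `crOp₁ = swap.crOp₀`; compare the two derivatives of the same family
  have h2 := congrArg Prod.snd (hF.unique hF')
  simp only [ContinuousLinearMap.coe_snd'] at h2
  -- assemble
  have eF : 𝒥.aCoeff₁ z⁻¹ x = _ := hF2.symm
  rw [eF, h2, hG2]
  simp [dbarClutch, smul_eq_mul]

/-- **Clutching of the normal-row coefficients** in the form used by `formMul`:
`a₁ w ((1 : ℂ → ℂ) w • x) = dbarClutch 1 w • a₀ w⁻¹ x` for `w ≠ 0`. [cite: Wendl2018, Thm. 2.46] -/
theorem aCoeff_clutch : ∀ w : ℂ, w ≠ 0 → ∀ x : ℂ,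
    𝒥.aCoeff₁ w ((1 : ℂ → ℂ) w • x) = dbarClutch (1 : ℂ → ℂ) w • 𝒥.aCoeff₀ w⁻¹ x := by
  intro w hw x
  rw [Pi.one_apply, one_smul]
  have h := 𝒥.aCoeff₁_inv_apply (inv_ne_zero hw) x
  rwa [inv_inv] at h

/-! ### The derivative of the Banach maps at the zero section, chartwise -/

section Banach

variable {r : ℝ≥0} (hr : r ≤ 1) (k : ℕ)

/-- The linear part of the `z`-jet map on the disc `‖z‖ < 4`: the 1-jet of the representatives
with first slot `0`. [folklore] -/
theorem jets₀CLM_apply_of_norm_lt (δ : SecPair k r) {z : ℂ} (hz : ‖z‖ < 4) :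
    jets₀CLM hr k δ z = ((0 : ℂ), sec₀ (fun w : ℂ => -w ^ 2) δ.1.1 z,
      fderiv ℝ (sec₀ (fun w : ℂ => -w ^ 2) δ.1.1) z, sec₀ (1 : ℂ → ℂ) δ.2.1 z,
      fderiv ℝ (sec₀ (1 : ℂ → ℂ) δ.2.1) z) := by
  have h := congrArg (fun u : ContDiffHolderFunction ℂ Jet k r => u z) (jets₀_sub hr k δ 0)
  simp only [sub_zero, ContDiffHolderFunction.coe_sub, Pi.sub_apply] at h
  rw [← h, jets₀_apply_of_norm_lt hr k δ hz, jets₀_zero_apply_of_norm_lt hr k hz]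
  ext <;> simp

/-- The linear part of the `w`-jet map on the disc `‖w‖ < 4`. [folklore] -/
theorem jets₁CLM_apply_of_norm_lt (δ : SecPair k r) {w : ℂ} (hw : ‖w‖ < 4) :
    jets₁CLM hr k δ w = ((0 : ℂ), sec₁ (fun w : ℂ => -w ^ 2) δ.1.1 w,
      fderiv ℝ (sec₁ (fun w : ℂ => -w ^ 2) δ.1.1) w, sec₁ (1 : ℂ → ℂ) δ.2.1 w,
      fderiv ℝ (sec₁ (1 : ℂ → ℂ) δ.2.1) w) := by
  have h := congrArg (fun u : ContDiffHolderFunction ℂ Jet k r => u w) (jets₁_sub hr k δ 0)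
  simp only [sub_zero, ContDiffHolderFunction.coe_sub, Pi.sub_apply] at h
  rw [← h, jets₁_apply_of_norm_lt hr k δ hw, jets₁_zero_apply_of_norm_lt hr k hw]
  ext <;> simp

variable {hr k}

/-- Representatives of level `k + 1 ≥ 2` are `C²`. [folklore] -/
theorem contDiff_two_sec₀_T (hk : 1 ≤ k) (δ : SecPair k r) :
    ContDiff ℝ 2 (sec₀ (fun w : ℂ => -w ^ 2) δ.1.1) :=
  (contDiff_sec₀ δ.1.2 neg_sq_clutch_ne_zero contDiffOn_neg_sq_clutch).of_le
    (by exact_mod_cast Nat.succ_le_succ hk)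

/-- Representatives of level `k + 1 ≥ 2` are `C²`. [folklore] -/
theorem contDiff_two_sec₀_N (hk : 1 ≤ k) (δ : SecPair k r) :
    ContDiff ℝ 2 (sec₀ (1 : ℂ → ℂ) δ.2.1) :=
  (contDiff_sec₀ δ.2.2 one_clutch_ne_zero contDiffOn_one_clutch).of_le
    (by exact_mod_cast Nat.succ_le_succ hk)

/-- Representatives of level `k + 1 ≥ 2` are `C²`. [folklore] -/
theorem contDiff_two_sec₁_T (hk : 1 ≤ k) (δ : SecPair k r) :
    ContDiff ℝ 2 (sec₁ (fun w : ℂ => -w ^ 2) δ.1.1) :=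
  (contDiff_sec₁ δ.1.2 contDiffOn_neg_sq_clutch).of_le (by exact_mod_cast Nat.succ_le_succ hk)

/-- Representatives of level `k + 1 ≥ 2` are `C²`. [folklore] -/
theorem contDiff_two_sec₁_N (hk : 1 ≤ k) (δ : SecPair k r) :
    ContDiff ℝ 2 (sec₁ (1 : ℂ → ℂ) δ.2.1) :=
  (contDiff_sec₁ δ.2.2 contDiffOn_one_clutch).of_le (by exact_mod_cast Nat.succ_le_succ hk)

/-- **Normal piece, chart `0`, of the derivative at the zero section**:
`(dPN 0 δ).1 z = ρ z • (∂ₓ δf⁰ + I ∂_y δf⁰ + a₀(z) δf⁰(z))` with `δf⁰ = sec₀ 1 δf` — for all `z`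
(both sides vanish for `‖z‖ ≥ 3`). [cite: Wendl2018, Thm. 2.46] -/
theorem dPN_zero_fst_apply (hk : 1 ≤ k) (δ : SecPair k r) (z : ℂ) :
    (𝒥.dPN hr k 0 δ).1 z = rhoCut z • (fderiv ℝ (sec₀ (1 : ℂ → ℂ) δ.2.1) z 1 +
      I * fderiv ℝ (sec₀ (1 : ℂ → ℂ) δ.2.1) z I + 𝒥.aCoeff₀ z (sec₀ (1 : ℂ → ℂ) δ.2.1 z)) := by
  by_cases hz : ‖z‖ < 4
  · rw [dPN_apply_fst, dout₀_apply, jets₀_zero_apply_of_norm_lt hr k hz, 𝒥.fderiv_phiCut₀ (by simp),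
      jets₀CLM_apply_of_norm_lt hr k δ hz, Prod.smul_snd,
      𝒥.fderiv_jetOp₀_axis_apply_snd (contDiff_two_sec₀_T hk δ) (contDiff_two_sec₀_N hk δ)]
  · have h3 : 3 ≤ ‖z‖ := le_trans (by norm_num) (not_lt.1 hz)
    rw [dPN_apply_fst, dout₀_apply, rhoCut_eq_zero h3, zero_smul, zero_smul, Prod.snd_zero]

/-- **Normal piece, chart `1`**: `(dPN 0 δ).2 w = ρ w • (∂ₓ δf¹ + I ∂_y δf¹ + a₁(w) δf¹(w))`.
[cite: Wendl2018, Thm. 2.46] -/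
theorem dPN_zero_snd_apply (hk : 1 ≤ k) (δ : SecPair k r) (w : ℂ) :
    (𝒥.dPN hr k 0 δ).2 w = rhoCut w • (fderiv ℝ (sec₁ (1 : ℂ → ℂ) δ.2.1) w 1 +
      I * fderiv ℝ (sec₁ (1 : ℂ → ℂ) δ.2.1) w I + 𝒥.aCoeff₁ w (sec₁ (1 : ℂ → ℂ) δ.2.1 w)) := by
  by_cases hw : ‖w‖ < 4
  · rw [dPN_apply_snd, dout₁_apply, jets₁_zero_apply_of_norm_lt hr k hw, 𝒥.fderiv_phiCut₁ (by simp),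
      jets₁CLM_apply_of_norm_lt hr k δ hw, Prod.smul_snd,
      𝒥.fderiv_jetOp₁_axis_apply_snd (contDiff_two_sec₁_T hk δ) (contDiff_two_sec₁_N hk δ)]
  · have h3 : 3 ≤ ‖w‖ := le_trans (by norm_num) (not_lt.1 hw)
    rw [dPN_apply_snd, dout₁_apply, rhoCut_eq_zero h3, zero_smul, zero_smul, Prod.snd_zero]

/-- **Tangent piece, chart `0`**: `(dPT 0 δ).1 z = ρ z • (∂ₓ δξ⁰ + I ∂_y δξ⁰ + m₀(z)(δf⁰ z, D δf⁰ z))`.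
[cite: Wendl2018, Thm. 2.46] -/
theorem dPT_zero_fst_apply (hk : 1 ≤ k) (δ : SecPair k r) (z : ℂ) :
    (𝒥.dPT hr k 0 δ).1 z = rhoCut z • (fderiv ℝ (sec₀ (fun w : ℂ => -w ^ 2) δ.1.1) z 1 +
      I * fderiv ℝ (sec₀ (fun w : ℂ => -w ^ 2) δ.1.1) z I +
      𝒥.mCoeff₀ z (sec₀ (1 : ℂ → ℂ) δ.2.1 z, fderiv ℝ (sec₀ (1 : ℂ → ℂ) δ.2.1) z)) := by
  by_cases hz : ‖z‖ < 4
  · rw [dPT_apply_fst, dout₀_apply, jets₀_zero_apply_of_norm_lt hr k hz, 𝒥.fderiv_phiCut₀ (by simp),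
      jets₀CLM_apply_of_norm_lt hr k δ hz, Prod.smul_fst,
      𝒥.fderiv_jetOp₀_axis_apply_fst (contDiff_two_sec₀_T hk δ) (contDiff_two_sec₀_N hk δ)]
  · have h3 : 3 ≤ ‖z‖ := le_trans (by norm_num) (not_lt.1 hz)
    rw [dPT_apply_fst, dout₀_apply, rhoCut_eq_zero h3, zero_smul, zero_smul, Prod.fst_zero]

/-- **Tangent piece, chart `1`**. [cite: Wendl2018, Thm. 2.46] -/
theorem dPT_zero_snd_apply (hk : 1 ≤ k) (δ : SecPair k r) (w : ℂ) :
    (𝒥.dPT hr k 0 δ).2 w = rhoCut w • (fderiv ℝ (sec₁ (fun w : ℂ => -w ^ 2) δ.1.1) w 1 +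
      I * fderiv ℝ (sec₁ (fun w : ℂ => -w ^ 2) δ.1.1) w I +
      𝒥.mCoeff₁ w (sec₁ (1 : ℂ → ℂ) δ.2.1 w, fderiv ℝ (sec₁ (1 : ℂ → ℂ) δ.2.1) w)) := by
  by_cases hw : ‖w‖ < 4
  · rw [dPT_apply_snd, dout₁_apply, jets₁_zero_apply_of_norm_lt hr k hw, 𝒥.fderiv_phiCut₁ (by simp),
      jets₁CLM_apply_of_norm_lt hr k δ hw, Prod.smul_fst,
      𝒥.fderiv_jetOp₁_axis_apply_fst (contDiff_two_sec₁_T hk δ) (contDiff_two_sec₁_N hk δ)]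
  · have h3 : 3 ≤ ‖w‖ := le_trans (by norm_num) (not_lt.1 hw)
    rw [dPT_apply_snd, dout₁_apply, rhoCut_eq_zero h3, zero_smul, zero_smul, Prod.fst_zero]

/-- **The normal rows do not see `δξ`**: `dPN 0 (δξ, δf) = dPN 0 (0, δf)`. [cite: Wendl2018, Thm. 2.46] -/
theorem dPN_zero_eq_of_snd_eq (hk : 1 ≤ k) (δ δ' : SecPair k r) (h : δ.2 = δ'.2) :
    𝒥.dPN hr k 0 δ = 𝒥.dPN hr k 0 δ' := by
  refine Prod.ext (ContDiffHolderFunction.ext fun z => ?_) (ContDiffHolderFunction.ext fun w => ?_)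
  · rw [𝒥.dPN_zero_fst_apply hk, 𝒥.dPN_zero_fst_apply hk, h]
  · rw [𝒥.dPN_zero_snd_apply hk, 𝒥.dPN_zero_snd_apply hk, h]

end Banach

end SphereACData

end SphereCR

end Literature.Geometry.Symplectic

end
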